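import Summits.AtomisticToContinuum.FouriersLaw.Theorems.OddSectorIrreversibilitySubBallisticWindowPartial

/-!
# `SubBallisticWindow` (stmt-AtomisticToContinuum-14070), line `Sketch`: the sharp ballistic envelope `ℓ² (1 + τ)`

Support file for crux `Summit.AtomisticToContinuum.FouriersLaw.Theses.OddSectorIrreversibility.SubBallisticWindow` (E2).
From the single-bond ceiling of `…SubBallisticWindow.Partial` (each bond's windowed transport has second moment
`≤ C₁ (1+τ) Z`, uniformly in `N` and the bond) and Cauchy–Schwarz over the `ℓ = k₂ - k₁` bonds of a block,
`V_B(τ) = ∫ (∫_{(0,τ]} (P⁰_t J_B)(x) dt)² e^{-H(x)/T} dx ≤ C ℓ² (1 + τ) Z` for every `N`, block and window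
(`sharpEnvelope`).  Together with the static envelope `V_B(τ) ≤ C ℓ τ² Z` (`Partial.exists_envelopes`) this is
`V_B(τ) ≤ C · ℓ (1+τ) · min(τ, ℓ) · Z`: the UNCONDITIONAL `N`-uniform knowledge is the crux E2 (`C ℓ (1+τ) Z`) up to
exactly the factor `min(τ, ℓ)` — the harmonic (ballistic) law, which the harmonic member saturates
(`Literature.Barriers.AtomisticToContinuum.HarmonicChainBallisticFlux`).  Winning that factor is the open content
of the one remaining stub `stub_correctorFamily` of the line.
-/

noncomputable section

namespace Summit.AtomisticToContinuum.FouriersLaw.Theorems.SubBallisticWindow.SharpEnvelope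

open MeasureTheory Filter Topology Set
open scoped NNReal ENNReal
open Literature.MathematicalPhysics.KineticTheory.HeatConduction
open Summit.AtomisticToContinuum.FouriersLaw.Theorems.ClosedConeSensitivity.Negative.ZeroFrictionDictionary
open Summit.AtomisticToContinuum.FouriersLaw.Theorems.OddSectorWitness
open Summit.AtomisticToContinuum.FouriersLaw.Theses.OddSectorIrreversibility

/-! ## Block windows are sums of single-bond windows -/

/-- The block current of the one-bond block `[i, i+1)` is the bond current `j_i`. [folklore] -/
theorem blockCurrent_single (ω₂ lam β γ : ℝ) (N : ℕ) (i : Fin N) (z : PhaseSpace N) :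
    blockCurrent ω₂ lam β γ N i.val (i.val + 1) z = (pinnedChain ω₂ lam β γ).bondCurrent N i z := by
  unfold blockCurrent
  have hiff : ∀ i' : Fin N, (i.val ≤ i'.val ∧ i'.val < i.val + 1) ↔ i' = i := fun i' => by
    constructor
    · intro h
      exact Fin.ext (by omega)
    · rintro rfl
      exact ⟨le_rfl, Nat.lt_succ_self _⟩
  rw [Finset.sum_congr rfl fun i' _ => if_congr (hiff i') rfl rfl]
  simp [Finset.sum_ite_eq']

variable {ω₂ lam β : ℝ} (hω : 0 < ω₂) (hl : 0 ≤ lam) (hβ : 0 ≤ β)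
include hω hl hβ

/-- The windowed block transport is the sum over the block's bonds of the single-bond windows:
`∫_{(0,τ]} J_B(Φ_t x) dt = ∑_{i ∈ B} ∫_{(0,τ]} j_i(Φ_t x) dt` (finite sum through the time integral; each
`t ↦ j_i(Φ_t x)` is continuous). [folklore] -/
theorem window_eq_sum_single (γ : ℝ) (N k₁ k₂ : ℕ) (τ : ℝ) (x : PhaseSpace N) :
    window ω₂ lam β γ N k₁ k₂ τ x = ∑ i : Fin N,
      (if k₁ ≤ i.val ∧ i.val < k₂ then window ω₂ lam β γ N i.val (i.val + 1) τ x else 0) := by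
  unfold window
  have hcont : ∀ i : Fin N, Continuous fun t : ℝ =>
      blockCurrent ω₂ lam β γ N i.val (i.val + 1) (detFlow ω₂ lam β N t x) := fun i =>
    (continuous_blockCurrent N γ i.val (i.val + 1)).comp (continuous_detFlow_time hω hl hβ N x)
  have hint : ∀ i ∈ (Finset.univ : Finset (Fin N)), IntegrableOn (fun t : ℝ =>
      if k₁ ≤ i.val ∧ i.val < k₂ then blockCurrent ω₂ lam β γ N i.val (i.val + 1) (detFlow ω₂ lam β N t x)
        else 0) (Ioc (0 : ℝ) τ) volume := by
    intro i _
    by_cases h : k₁ ≤ i.val ∧ i.val < k₂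
    · simp only [if_pos h]
      exact (hcont i).integrableOn_Ioc
    · simp only [if_neg h]
      exact integrableOn_zero
  have hpt : ∀ t : ℝ, blockCurrent ω₂ lam β γ N k₁ k₂ (detFlow ω₂ lam β N t x) = ∑ i : Fin N,
      (if k₁ ≤ i.val ∧ i.val < k₂ then blockCurrent ω₂ lam β γ N i.val (i.val + 1) (detFlow ω₂ lam β N t x)
        else 0) := fun t => by
    conv_lhs => unfold blockCurrent
    refine Finset.sum_congr rfl fun i _ => ?_
    split_ifs
    · rw [blockCurrent_single]
    · rfl
  simp_rw [hpt]
  rw [integral_finsetSum _ hint]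
  refine Finset.sum_congr rfl fun i _ => ?_
  split_ifs
  · rfl
  · simp

/-! ## The single-bond constant and the sharp envelope -/

/-- **Single-bond window ceiling** (`window`/`gibbsWeight` vocabulary, `N`-uniform): there is `C₁ ≥ 0` with
`∫ (∫_{(0,τ]} j_i(Φ_t x) dt)² dμ_T ≤ C₁ (1+τ) Z` for every `N`, bond `i` with `i + 2 ≤ N` and `τ ≥ 0`
(static envelope for `τ ≤ 1`, return ramp for `τ ≥ 1`). [folklore] -/
theorem exists_singleBond_constant (γ : ℝ) {T : ℝ} (hT : 0 < T) :
    ∃ C₁ : ℝ, 0 ≤ C₁ ∧ ∀ (N i : ℕ), i + 2 ≤ N → ∀ τ : ℝ, 0 ≤ τ →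
      ∫ x, (window ω₂ lam β γ N i (i + 1) τ x) ^ 2 ∂(gibbsWeight ω₂ lam β γ N T) ≤
        C₁ * (1 + τ) * ∫ x : PhaseSpace N, Real.exp (-((pinnedChain ω₂ lam β γ).hamiltonian N x) / T) := by
  obtain ⟨CJ, CE, hCJ0, hCE0, hstat, hramp⟩ := Partial.exists_envelopes hω hl hβ γ hT
  refine ⟨2 * CJ + CE, by positivity, fun N i hi τ hτ => ?_⟩
  set Z := ∫ y, Real.exp (-((pinnedChain ω₂ lam β γ).hamiltonian N y) / T) ∂volume with hZ
  have hZ0 : 0 ≤ Z := integral_nonneg fun _ => (Real.exp_pos _).le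
  have hone : ((i + 1 : ℕ) : ℝ) - (i : ℕ) = 1 := by push_cast; ring
  rcases le_or_gt τ 1 with hτ1 | hτ1
  · have h1 := hstat N i (i + 1) (Nat.le_succ _) τ hτ
    rw [hone, mul_one] at h1
    refine h1.trans ?_
    have hτ2 : τ ^ 2 ≤ 1 + τ := by nlinarith
    nlinarith [mul_nonneg hCJ0 hZ0, mul_nonneg hCE0 hZ0]
  · have h1 := hramp N i (i + 1) (Nat.le_succ _) (by omega) τ hτ1.le
    rw [hone] at h1
    refine h1.trans ?_
    nlinarith [mul_nonneg hCJ0 hZ0, mul_nonneg hCE0 hZ0]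

omit hω hl hβ in
/-- **Sharp ballistic envelope** (`N`-uniform). For `ω₂ > 0`, `lam, β ≥ 0`, any `γ`, `T > 0` there is `C` with, for
every `N`, block `[k₁,k₂)` (`k₂ + 1 ≤ N`) and window `τ ≥ 0`,
`∫ (∫_{(0,τ]} (P⁰_t J_B)(x) dt)² e^{-H(x)/T} dx ≤ C (k₂ - k₁)² (1 + τ) Z` (Cauchy–Schwarz over the bonds of the
block and the single-bond ceiling). With the static envelope `C ℓ τ² Z` this leaves exactly the factor
`min(τ, ℓ)` between the unconditional knowledge and the crux E2. [folklore] -/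
theorem sharpEnvelope :
    ∀ ω₂ lam β γ : ℝ, 0 < ω₂ → 0 ≤ lam → 0 ≤ β → ∀ T : ℝ, 0 < T → ∃ C : ℝ, ∀ (N k₁ k₂ : ℕ), k₁ ≤ k₂ →
      k₂ + 1 ≤ N → ∀ τ : ℝ, 0 ≤ τ →
      let P := pinnedChain ω₂ lam β γ;
      let P₀ := pinnedChain ω₂ lam β 0;
      let μT : Measure (PhaseSpace N) :=
        volume.withDensity (fun x : PhaseSpace N => ENNReal.ofReal (Real.exp (-(P.hamiltonian N x) / T)));
      let JB : PhaseSpace N → ℝ := fun z => ∑ i : Fin N,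
        (if k₁ ≤ i.val ∧ i.val < k₂ then P.bondCurrent N i z else 0);
      ∫ x, (∫ t in Set.Ioc (0 : ℝ) τ, (∫ y, JB y ∂(P₀.transitionKernel N T T t.toNNReal x))) ^ 2 ∂μT ≤
        C * ((k₂ : ℝ) - k₁) ^ 2 * (1 + τ) * ∫ x, Real.exp (-(P.hamiltonian N x) / T) ∂volume := by
  intro ω₂ lam β γ hω hl hβ T hT
  obtain ⟨C₁, hC₁0, hC₁⟩ := exists_singleBond_constant hω hl hβ γ hT
  refine ⟨C₁, fun N k₁ k₂ hk hkN τ hτ => ?_⟩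
  simp only
  set Z := ∫ y, Real.exp (-((pinnedChain ω₂ lam β γ).hamiltonian N y) / T) ∂volume with hZ
  have hZ0 : 0 ≤ Z := integral_nonneg fun _ => (Real.exp_pos _).le
  have hℓ0 : (0 : ℝ) ≤ (k₂ : ℝ) - k₁ := sub_nonneg.mpr (by exact_mod_cast hk)
  -- Dirac dictionary: the crux's left-hand side is `∫ window² dμ_T`
  have hdict := Partial.integral_window_kernel_eq hω hl hβ γ N k₁ k₂ T τ (gibbsWeight ω₂ lam β γ N T)
  simp only [blockCurrent] at hdict
  rw [show (volume.withDensity fun x : PhaseSpace N =>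
      ENNReal.ofReal (Real.exp (-((pinnedChain ω₂ lam β γ).hamiltonian N x) / T))) =
      gibbsWeight ω₂ lam β γ N T from rfl, hdict]
  change ∫ x, (window ω₂ lam β γ N k₁ k₂ τ x) ^ 2 ∂(gibbsWeight ω₂ lam β γ N T) ≤ _
  -- the block's bonds as a finset, of cardinality `≤ ℓ`
  set B : Finset (Fin N) := Finset.univ.filter fun i : Fin N => k₁ ≤ i.val ∧ i.val < k₂ with hB
  have hcard : ((B.card : ℕ) : ℝ) ≤ (k₂ : ℝ) - k₁ := StaticCurrentBound.card_filter_le hk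
  -- pointwise Cauchy–Schwarz over the bonds
  set a : Fin N → PhaseSpace N → ℝ := fun i x => window ω₂ lam β γ N i.val (i.val + 1) τ x with ha
  have hwin : ∀ x, window ω₂ lam β γ N k₁ k₂ τ x = ∑ i ∈ B, a i x := fun x => by
    rw [window_eq_sum_single hω hl hβ γ N k₁ k₂ τ x, Finset.sum_filter]
  have hpt : ∀ x, (window ω₂ lam β γ N k₁ k₂ τ x) ^ 2 ≤ ((k₂ : ℝ) - k₁) * ∑ i ∈ B, (a i x) ^ 2 := fun x => by
    rw [hwin x]
    calc (∑ i ∈ B, a i x) ^ 2 ≤ B.card * ∑ i ∈ B, (a i x) ^ 2 := sq_sum_le_card_mul_sum_sq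
      _ ≤ ((k₂ : ℝ) - k₁) * ∑ i ∈ B, (a i x) ^ 2 :=
          mul_le_mul_of_nonneg_right hcard (Finset.sum_nonneg fun i _ => sq_nonneg _)
  -- integrability of every single-bond window squared, and the single-bond ceiling for the block's bonds
  have hInt : ∀ i ∈ B, Integrable (fun x => (a i x) ^ 2) (gibbsWeight ω₂ lam β γ N T) := fun i _ =>
    integrable_window_sq hω hl hβ N γ i.val (i.val + 1) hτ hT
  have hbd : ∀ i ∈ B, ∫ x, (a i x) ^ 2 ∂(gibbsWeight ω₂ lam β γ N T) ≤ C₁ * (1 + τ) * Z := by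
    intro i hi
    have hi' : i.val < k₂ := ((Finset.mem_filter.mp hi).2).2
    exact hC₁ N i.val (by omega) τ hτ
  calc ∫ x, (window ω₂ lam β γ N k₁ k₂ τ x) ^ 2 ∂(gibbsWeight ω₂ lam β γ N T)
      ≤ ∫ x, ((k₂ : ℝ) - k₁) * ∑ i ∈ B, (a i x) ^ 2 ∂(gibbsWeight ω₂ lam β γ N T) :=
        integral_mono_of_nonneg (Eventually.of_forall fun x => sq_nonneg _)
          ((integrable_finsetSum B hInt).const_mul _) (Eventually.of_forall hpt)
    _ = ((k₂ : ℝ) - k₁) * ∑ i ∈ B, ∫ x, (a i x) ^ 2 ∂(gibbsWeight ω₂ lam β γ N T) := by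
        rw [integral_const_mul, integral_finsetSum B hInt]
    _ ≤ ((k₂ : ℝ) - k₁) * ∑ _i ∈ B, C₁ * (1 + τ) * Z :=
        mul_le_mul_of_nonneg_left (Finset.sum_le_sum hbd) hℓ0
    _ = ((k₂ : ℝ) - k₁) * (B.card * (C₁ * (1 + τ) * Z)) := by rw [Finset.sum_const, nsmul_eq_mul]
    _ ≤ ((k₂ : ℝ) - k₁) * (((k₂ : ℝ) - k₁) * (C₁ * (1 + τ) * Z)) := by
        refine mul_le_mul_of_nonneg_left (mul_le_mul_of_nonneg_right hcard ?_) hℓ0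
        have : 0 ≤ 1 + τ := by linarith
        positivity
    _ = C₁ * ((k₂ : ℝ) - k₁) ^ 2 * (1 + τ) * Z := by ring

end Summit.AtomisticToContinuum.FouriersLaw.Theorems.SubBallisticWindow.SharpEnvelope

end
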